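import Summits.CriticalPhenomena.PercolationContinuityZ3.Theorems.Transplant.SqShadowRouteData
import Summits.CriticalPhenomena.PercolationContinuityZ3.Theorems.Transplant.SqShadowGlueEvents
import HarnessLib

/-!
# SQUARE SHADOWS — the cleared blocks of the local surgery: geometry of `D(z)` and `RP(z)` inside the window `B_{3n} ∪ B'_n` (square twin of «HexShadowBlocks»)

builds on p205010 (kernel theorem, internal audit signed; external expert review pending) — NOT used in this file.  Lane `prim-bschramm`, seat `prim-bschramm-p2` (gen 42; class C1b;
memo `HOME/bschramm/P2-LATTICES.md` §148); helper file (`--supports stmt-CriticalPhenomena-4575 --as helper`).  Slab original: `Literature/…/SlabGluingRouting` §"The cleared box around a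
point of `U(ω)`"; hexagonal twin «HexShadowBlocks».

In coordinates relative to the centre `c` (`ξ = w₀ − c₀`, `η = w₁ − c₁`): `big = B_{3n} = {|ξ|, |η| ≤ 3m}` (`m = n`), `small = B'_n = {|ξ − 2m| ≤ m, |η − P·s| ≤ m}` with `0 ≤ P·s ≤ 3m`;
the only sides of the window that pass near unboundedly many points of `U(ω) ⊆ big ∩ small` are the common right side LINE `{ξ = 3m}` and the top sides `{η = 3m}` of `big` /
`{η = P·s + m}` of `small`.  Hence
* §1 linear membership tests, the clip parameters `tD, sD, tR, sR` and the blocks **`Dblk Γ z = sqBall z 3 ∩ {ξ ≤ 3m} ∩ {η ≤ 3m + (P·s − 2m)⁺}`** (the cleared columns) and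
  **`RPblk Γ z = sqBall z 3 ∩ {ξ ≤ 3m (− 1 if Z_n meets the block)} ∩ {η ≤ 3m}`** (the columns of the rerouted piece);
* §2 the inclusions the surgery needs: `RPblk ⊆ Dblk ⊆ sqBall z 3`, `Dblk ⊆ big ∪ small` (off the exceptional set `X₁` near the top-left corner of `small ∩ {η > 3m}`), `RPblk ⊆ big`,
  `RPblk ∩ Z_n = ∅` (off `zBad`), `sqBall z 3 ∩ big ⊆ Dblk`, `sqBall z 3 ∩ small ⊆ Dblk`, `Dblk ∩ S_{3n} = ∅` (`m ≥ 13`: `ξ ≥ m − 3 > 3m/4 ≥ u₃`), and "clipped in at most one direction"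
  off `X₂`;
* §3 the exceptional sets `X₁`, `X₂`, `zBad` lie in lattice squares of bounded radius (so that Fact 2 loses only boundedly many points of `U(ω)`).
[cite: DuminilCopinSidoraviciusTassion2016, §2.3 (proof of Fact 2: the balls B_R(z), B_{R+1}(z) inside B_{3n} ∪ B'_n)]
-/

noncomputable section

namespace Summit.CriticalPhenomena.PercolationContinuityZ3.Theorems.Transplant

open MeasureTheory Literature.Probability.Percolation Literature.Probability.LatticeModels SimpleGraph Filter
open scoped Classical Topology

/-! ## §1 Linear membership tests; the clip parameters and the blocks -/

/-- Membership in a clipped square block, in linear form. [folklore] -/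
theorem mem_sqBlk_iff_lin {z : Site 2} {t s : ℕ} {w : Site 2} :
    w ∈ sqBlk z t s ↔ ((-(3 : ℤ) ≤ w 0 - z 0 ∧ w 0 - z 0 ≤ 3) ∧ (-(3 : ℤ) ≤ w 1 - z 1 ∧ w 1 - z 1 ≤ 3)) ∧ w 0 ≤ z 0 + t ∧ w 1 ≤ z 1 + s := by
  rw [mem_sqBlk, mem_sqBall_iff_linear]; push_cast; omega

/-- Membership in a side segment of `B'`, in coordinates. [folklore] -/
theorem mem_sqSide_iff' {z : Site 2} {m : ℕ} {α β : ℤ} {w : Site 2} : w ∈ SqShadow.sqSide z m α β ↔ w 0 = z 0 + m ∧ α ≤ w 1 - z 1 ∧ w 1 - z 1 ≤ β := Iff.rfl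

namespace SqShadow

variable {V : Type} {G : SimpleGraph V} (Ψ : SqShadow G)

/-- Membership in `big`, in linear form relative to the centre. [folklore] -/
theorem mem_big_iff (Γ : GlueData) (w : Site 2) :
    w ∈ Ψ.big Γ ↔ (-(3 * (Γ.m : ℤ)) ≤ w 0 - Ψ.centre 0 ∧ w 0 - Ψ.centre 0 ≤ 3 * Γ.m) ∧ (-(3 * (Γ.m : ℤ)) ≤ w 1 - Ψ.centre 1 ∧ w 1 - Ψ.centre 1 ≤ 3 * Γ.m) := by
  rw [big, mem_sqBall_iff_linear]; push_cast; omega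

/-- Membership in `small`, in linear form relative to the centre. [folklore] -/
theorem mem_small_iff (Γ : GlueData) (w : Site 2) :
    w ∈ Ψ.small Γ ↔ (-(Γ.m : ℤ) ≤ w 0 - (Ψ.centre 0 + 2 * Γ.m) ∧ w 0 - (Ψ.centre 0 + 2 * Γ.m) ≤ Γ.m) ∧
      (-(Γ.m : ℤ) ≤ w 1 - (Ψ.centre 1 + Ψ.period * Γ.s) ∧ w 1 - (Ψ.centre 1 + Ψ.period * Γ.s) ≤ Γ.m) := by
  rw [small, mem_sqBall_iff_linear, (Ψ.glueCentre_apply Γ.m Γ.s).1, (Ψ.glueCentre_apply Γ.m Γ.s).2]; omega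

/-- Membership in `src = S_{3n}`, in linear form. [folklore] -/
theorem mem_src_iff (Γ : GlueData) (w : Site 2) :
    w ∈ Ψ.src Γ ↔ (-(Γ.u₃ : ℤ) ≤ w 0 - Ψ.centre 0 ∧ w 0 - Ψ.centre 0 ≤ Γ.u₃) ∧ (-(Γ.u₃ : ℤ) ≤ w 1 - Ψ.centre 1 ∧ w 1 - Ψ.centre 1 ≤ Γ.u₃) := by
  rw [src, mem_sqBall_iff_linear]; omega

/-- Membership in `Z_n`, in coordinates. [folklore] -/
theorem mem_zSeg_iff (Γ : GlueData) (w : Site 2) :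
    w ∈ Ψ.zSeg Γ ↔ w 0 = Ψ.centre 0 + 3 * Γ.m ∧ -(Γ.a : ℤ) ≤ w 1 - (Ψ.centre 1 + Ψ.period * Γ.s) ∧ w 1 - (Ψ.centre 1 + Ψ.period * Γ.s) ≤ Γ.a := by
  rw [zSeg, mem_sqSide, (Ψ.glueCentre_apply Γ.m Γ.s).1, (Ψ.glueCentre_apply Γ.m Γ.s).2]
  constructor
  · rintro ⟨h1, h2, h3⟩; exact ⟨by rw [h1]; ring, h2, h3⟩
  · rintro ⟨h1, h2, h3⟩; exact ⟨by rw [h1]; ring, h2, h3⟩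

/-- The `ξ`-clip parameter of the cleared block: `3m − ξ(z)`. [cite: DuminilCopinSidoraviciusTassion2016, §2.3, proof of Fact 2] -/
def tD (Γ : GlueData) (z : Site 2) : ℕ := (Ψ.centre 0 + 3 * Γ.m - z 0).toNat

/-- The `η`-clip parameter of the cleared block: `3m + (P·s − 2m)⁺ − η(z)` (the top of the window over the columns of `B'`). [cite: DuminilCopinSidoraviciusTassion2016, §2.3, proof of Fact 2] -/
def sD (Γ : GlueData) (z : Site 2) : ℕ := (Ψ.centre 1 + 3 * Γ.m + max (Ψ.period * Γ.s - 2 * Γ.m) 0 - z 1).toNat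

/-- The `η`-clip parameter of the rerouting block: `3m − η(z)`. [cite: DuminilCopinSidoraviciusTassion2016, §2.3, proof of Fact 2] -/
def sR (Γ : GlueData) (z : Site 2) : ℕ := (Ψ.centre 1 + 3 * Γ.m - z 1).toNat

/-- `Z_n` meets the unit square `sqBall z 3`. [folklore] -/
def zTouch (Γ : GlueData) (z : Site 2) : Prop := ∃ w ∈ sqBall z 3, w ∈ Ψ.zSeg Γ

/-- The `ξ`-clip parameter of the rerouting block: one less than that of the cleared block when `Z_n` meets the unit square (the column line of `Z_n` is then dropped), else the
same. [cite: DuminilCopinSidoraviciusTassion2016, §2.3, proof of Fact 2] -/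
def tR (Γ : GlueData) (z : Site 2) : ℕ := if Ψ.zTouch Γ z then Ψ.tD Γ z - 1 else Ψ.tD Γ z

/-- **The cleared block `D(z)`** (the formalisation's `\overline{B_R(z)}`, `R = 3`, clipped to the window). [cite: DuminilCopinSidoraviciusTassion2016, §2.3, proof of Fact 2 (the ball B_R(z))] -/
def Dblk (Γ : GlueData) (z : Site 2) : Set (Site 2) := sqBlk z (Ψ.tD Γ z) (Ψ.sD Γ z)

/-- **The rerouting block `RP(z)`**: the part of `D(z)` in `B_{3n}`, minus the column line of `Z_n` when `Z_n` meets the unit square.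
[cite: DuminilCopinSidoraviciusTassion2016, §2.3, proof of Fact 2] -/
def RPblk (Γ : GlueData) (z : Site 2) : Set (Site 2) := sqBlk z (Ψ.tR Γ z) (Ψ.sR Γ z)

/-- The exceptional points near the top-left inner corner of the window (left side of `small` above the top of `big`), where `D(z)` could leave the window. [folklore] -/
def X₁ (Γ : GlueData) : Set (Site 2) := {z | z 0 ≤ Ψ.centre 0 + Γ.m + 2 ∧ Ψ.centre 1 + 3 * Γ.m - 2 ≤ z 1}

/-- The exceptional points near the top-right corner `c + (3m, 3m)` of `B_{3n}` (where both clips are active). [folklore] -/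
def X₂ (Γ : GlueData) : Set (Site 2) := {z | Ψ.centre 0 + 3 * Γ.m - 4 ≤ z 0 ∧ Ψ.centre 1 + 3 * Γ.m - 4 ≤ z 1}

/-- The exceptional points whose unit square is cut PARTIALLY by `Z_n` (near the two ends of `Z_n`). [folklore] -/
def zBad (Γ : GlueData) : Set (Site 2) := {z | Ψ.zTouch Γ z ∧ ∃ w ∈ sqBall z 3, w 0 = Ψ.centre 0 + 3 * Γ.m ∧ w ∉ Ψ.zSeg Γ}

/-! ## §2 The inclusions -/

variable {Ψ}

/-- `RP(z) ⊆ D(z)`. [folklore] -/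
theorem RPblk_subset_Dblk (Γ : GlueData) (z : Site 2) : Ψ.RPblk Γ z ⊆ Ψ.Dblk Γ z := by
  refine sqBlk_mono z ?_ ?_
  · unfold tR; split_ifs <;> omega
  · unfold sR sD
    have : (0 : ℤ) ≤ max (Ψ.period * Γ.s - 2 * Γ.m) 0 := le_max_right _ _
    omega

/-- The clip parameters of `RP(z)` are at most those of `D(z)`. [folklore] -/
theorem tR_le_tD (Γ : GlueData) (z : Site 2) : Ψ.tR Γ z ≤ Ψ.tD Γ z ∧ Ψ.sR Γ z ≤ Ψ.sD Γ z := by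
  refine ⟨?_, ?_⟩
  · unfold tR; split_ifs <;> omega
  · unfold sR sD
    have : (0 : ℤ) ≤ max (Ψ.period * Γ.s - 2 * Γ.m) 0 := le_max_right _ _
    omega

/-- `D(z) ⊆ sqBall z 3`. [folklore] -/
theorem Dblk_subset_sqBall (Γ : GlueData) (z : Site 2) : Ψ.Dblk Γ z ⊆ sqBall z 3 := sqBlk_subset_sqBall _ _ _

/-- **`sqBall z 3 ∩ B_{3n} ⊆ D(z)`.** [folklore] -/
theorem sqBall_inter_big_subset_Dblk (Γ : GlueData) (z : Site 2) {w : Site 2} (hw : w ∈ sqBall z 3) (hwb : w ∈ Ψ.big Γ) : w ∈ Ψ.Dblk Γ z := by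
  rw [mem_big_iff] at hwb
  refine ⟨hw, ?_, ?_⟩
  · unfold tD; omega
  · unfold sD
    have : (0 : ℤ) ≤ max (Ψ.period * Γ.s - 2 * Γ.m) 0 := le_max_right _ _
    omega

/-- **`sqBall z 3 ∩ B'_n ⊆ D(z)`.** [folklore] -/
theorem sqBall_inter_small_subset_Dblk (Γ : GlueData) (z : Site 2) {w : Site 2} (hw : w ∈ sqBall z 3) (hws : w ∈ Ψ.small Γ) : w ∈ Ψ.Dblk Γ z := by
  rw [mem_small_iff] at hws
  refine ⟨hw, ?_, ?_⟩
  · unfold tD; omega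
  · unfold sD
    have : Ψ.period * Γ.s - 2 * Γ.m ≤ max (Ψ.period * Γ.s - 2 * Γ.m) 0 := le_max_left _ _
    omega

/-- **`RP(z) ⊆ B_{3n}`** for `z ∈ big ∩ small`, `m ≥ 13`. [folklore] -/
theorem RPblk_subset_big {Γ : GlueData} (hΓ : Ψ.InRange Γ) (hm : 13 ≤ Γ.m) {z : Site 2} (hzb : z ∈ Ψ.big Γ) (hzs : z ∈ Ψ.small Γ) :
    Ψ.RPblk Γ z ⊆ Ψ.big Γ := by
  intro w hw
  obtain ⟨-, -, -, -, -, hs1, hs2⟩ := hΓ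
  rw [RPblk, mem_sqBlk_iff_lin] at hw
  rw [mem_big_iff] at hzb ⊢
  rw [mem_small_iff] at hzs
  have htR : (Ψ.tR Γ z : ℤ) ≤ Ψ.centre 0 + 3 * Γ.m - z 0 := by
    have h1 : Ψ.tR Γ z ≤ Ψ.tD Γ z := (tR_le_tD Γ z).1
    have h2 : ((Ψ.tD Γ z : ℕ) : ℤ) = Ψ.centre 0 + 3 * Γ.m - z 0 := by unfold tD; omega
    omega
  have hsR : ((Ψ.sR Γ z : ℕ) : ℤ) = Ψ.centre 1 + 3 * Γ.m - z 1 := by unfold sR; omega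
  omega

/-- **`D(z) ⊆ B_{3n} ∪ B'_n`** for `z ∈ big ∩ small` off `X₁`, `m ≥ 13`. [cite: DuminilCopinSidoraviciusTassion2016, §2.3, proof of Fact 2 (B_{R+1}(z) inside B_{3n} ∪ B'_n)] -/
theorem Dblk_subset_window {Γ : GlueData} (hΓ : Ψ.InRange Γ) (hm : 13 ≤ Γ.m) {z : Site 2} (hzb : z ∈ Ψ.big Γ) (hzs : z ∈ Ψ.small Γ) (hX : z ∉ Ψ.X₁ Γ) :
    Ψ.Dblk Γ z ⊆ Ψ.big Γ ∪ Ψ.small Γ := by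
  intro w hw
  obtain ⟨-, -, -, -, -, hs1, hs2⟩ := hΓ
  rw [Dblk, mem_sqBlk_iff_lin] at hw
  simp only [X₁, Set.mem_setOf_eq, not_and_or, not_le] at hX
  rw [Set.mem_union, mem_big_iff, mem_small_iff]
  rw [mem_big_iff] at hzb
  rw [mem_small_iff] at hzs
  have htD : ((Ψ.tD Γ z : ℕ) : ℤ) = Ψ.centre 0 + 3 * Γ.m - z 0 := by unfold tD; omega
  have hsD : ((Ψ.sD Γ z : ℕ) : ℤ) = Ψ.centre 1 + 3 * Γ.m + max (Ψ.period * Γ.s - 2 * Γ.m) 0 - z 1 := by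
    unfold sD
    have : (0 : ℤ) ≤ max (Ψ.period * Γ.s - 2 * Γ.m) 0 := le_max_right _ _
    omega
  by_cases hη : w 1 - Ψ.centre 1 ≤ 3 * Γ.m
  · left; omega
  · right
    have hmax : max (Ψ.period * Γ.s - 2 * Γ.m) 0 = Ψ.period * Γ.s - 2 * Γ.m := by
      rcases le_or_gt (Ψ.period * Γ.s - 2 * Γ.m) 0 with h | h
      · exfalso; rw [max_eq_right h] at hsD; omega
      · exact max_eq_left h.le
    rw [hmax] at hsD
    omega

/-- **`RP(z)` misses `Z_n`** for `z ∈ B_{3n} ∖ Z_n` off `zBad`. [folklore] -/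
theorem RPblk_disjoint_zSeg {Γ : GlueData} {z : Site 2} (hzbig : z ∈ Ψ.big Γ) (hzZ : z ∉ Ψ.zSeg Γ) (hzb : z ∉ Ψ.zBad Γ) {w : Site 2}
    (hw : w ∈ Ψ.RPblk Γ z) : w ∉ Ψ.zSeg Γ := by
  intro hwZ
  have htouch : Ψ.zTouch Γ z := ⟨w, sqBlk_subset_sqBall _ _ _ hw, hwZ⟩
  have hall : ∀ w' ∈ sqBall z 3, w' 0 = Ψ.centre 0 + 3 * Γ.m → w' ∈ Ψ.zSeg Γ := by
    intro w' hw' h0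
    by_contra hnot
    exact hzb ⟨htouch, w', hw', h0, hnot⟩
  have htR : Ψ.tR Γ z = Ψ.tD Γ z - 1 := by simp [tR, htouch]
  rw [RPblk, mem_sqBlk_iff_lin, htR] at hw
  rw [mem_zSeg_iff] at hwZ
  rw [mem_big_iff] at hzbig
  rcases Nat.eq_zero_or_pos (Ψ.tD Γ z) with h0 | hpos
  · -- `z` lies on the column line of `Z_n`, hence in `Z_n`
    have hz0 : z 0 = Ψ.centre 0 + 3 * Γ.m := by unfold tD at h0; omega
    exact hzZ (hall z (centre_mem_sqBall z 3) hz0)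
  · have : ((Ψ.tD Γ z - 1 : ℕ) : ℤ) = Ψ.centre 0 + 3 * Γ.m - z 0 - 1 := by unfold tD at hpos ⊢; omega
    omega

/-- **`D(z)` misses `S_{3n}`** for `z ∈ B'_n`, `m ≥ 13` (`dist(B'_n, S_{3n}) ≥ m − 3m/4 > 3`). [folklore] -/
theorem Dblk_disjoint_src {Γ : GlueData} (hΓ : Ψ.InRange Γ) (hm : 13 ≤ Γ.m) {z : Site 2} (hzs : z ∈ Ψ.small Γ) {w : Site 2} (hw : w ∈ Ψ.Dblk Γ z) :
    w ∉ Ψ.src Γ := by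
  intro hws
  obtain ⟨-, hu₃, -, -, -, hs1, hs2⟩ := hΓ
  rw [Dblk, mem_sqBlk_iff_lin] at hw
  rw [mem_small_iff] at hzs
  rw [mem_src_iff] at hws
  omega

/-- **Off `X₂`, the blocks are clipped in at most one direction.** [folklore] -/
theorem three_le_tR_or_sR {Γ : GlueData} {z : Site 2} (hX : z ∉ Ψ.X₂ Γ) : 3 ≤ Ψ.tR Γ z ∨ 3 ≤ Ψ.sR Γ z := by
  simp only [X₂, Set.mem_setOf_eq, not_and_or, not_le] at hX
  rcases hX with h | h
  · left
    have : 4 ≤ Ψ.tD Γ z := by unfold tD; omega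
    unfold tR; split_ifs <;> omega
  · right; unfold sR; omega

/-- A point of `big` has `ξ(z) ≤ 3m`, so `tD` is the honest difference. [folklore] -/
theorem tD_cast {Γ : GlueData} {z : Site 2} (hzb : z ∈ Ψ.big Γ) : ((Ψ.tD Γ z : ℕ) : ℤ) = Ψ.centre 0 + 3 * Γ.m - z 0 := by
  rw [mem_big_iff] at hzb; unfold tD; omega

/-! ## §3 The exceptional sets are bounded -/

/-- `X₁ ∩ big ∩ small` lies in the square of radius `3` about the point `c + (m, 3m)`. [folklore] -/
theorem X₁_subset {Γ : GlueData} {z : Site 2} (hz : z ∈ Ψ.X₁ Γ) (hzb : z ∈ Ψ.big Γ) (hzs : z ∈ Ψ.small Γ) :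
    z ∈ sqBall (Ψ.centre + ![(Γ.m : ℤ), 3 * Γ.m]) 3 := by
  simp only [X₁, Set.mem_setOf_eq] at hz
  rw [mem_big_iff] at hzb
  rw [mem_small_iff] at hzs
  rw [mem_sqBall_iff_linear]
  simp only [Pi.add_apply, Matrix.cons_val_zero, Matrix.cons_val_one]
  omega

/-- `X₂` (within `big`) lies in the square of radius `4` about the corner `c + (3m, 3m)` of `big`. [folklore] -/
theorem X₂_subset {Γ : GlueData} {z : Site 2} (hz : z ∈ Ψ.X₂ Γ) (hzb : z ∈ Ψ.big Γ) : z ∈ sqBall (Ψ.centre + ![3 * (Γ.m : ℤ), 3 * Γ.m]) 4 := by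
  simp only [X₂, Set.mem_setOf_eq] at hz
  rw [mem_big_iff] at hzb
  rw [mem_sqBall_iff_linear]
  simp only [Pi.add_apply, Matrix.cons_val_zero, Matrix.cons_val_one]
  omega

/-- `zBad` lies in the two squares of radius `12` about the ends `c + (3m, P·s ∓ a)` of `Z_n`. [folklore] -/
theorem zBad_subset {Γ : GlueData} {z : Site 2} (hz : z ∈ Ψ.zBad Γ) :
    z ∈ sqBall (Ψ.centre + ![3 * (Γ.m : ℤ), Ψ.period * Γ.s - Γ.a]) 12 ∨ z ∈ sqBall (Ψ.centre + ![3 * (Γ.m : ℤ), Ψ.period * Γ.s + Γ.a]) 12 := by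
  obtain ⟨⟨w, hw, hwZ⟩, w', hw', hw'0, hw'Z⟩ := hz
  rw [mem_zSeg_iff] at hwZ hw'Z
  rw [mem_sqBall_iff_linear] at hw hw'
  simp only [not_and_or, not_le] at hw'Z
  rw [mem_sqBall_iff_linear, mem_sqBall_iff_linear]
  simp only [Pi.add_apply, Matrix.cons_val_zero, Matrix.cons_val_one]
  rcases hw'Z with h | h | h
  · exact absurd hw'0 h
  · left; omega
  · right; omega

end SqShadow

end Summit.CriticalPhenomena.PercolationContinuityZ3.Theorems.Transplant

end
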